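import Literature.AnabelianGeometry.EtaleTheta.LogDivisorModelTateTowerThetaTwistKummerAction
import Literature.AnabelianGeometry.EtaleTheta.LogDivisorModelTateTowerKummerTwistGroupRShear

/-!
# [EtTh] Def. 3.3 (iii) at a Kummer LEVEL of the `Ÿ`-skeleton: the TRANSLATIONS `ℤ_γ` acting on the level — root-of-unity corrected,
# structure-preserving — and the Heisenberg-type relation `T_a K_κ T_a⁻¹ = K_{σ_a κ}` with the Kummer action (2b(ii) KNIT PREP, class (b))

S. Mochizuki, *The étale theta function …*, Publ. RIMS **45** (2009) [MochizukiEtTh2009], Prop. 1.4 (ii) p.22 (the functional equation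
`Θ̈(ξ·Ü) = (−1)^a q^{−a²/2} Ü^{−2a} Θ̈(Ü)` of the translations), §1 p.13 (roots / roots of unity of the Kummer coverings), Def. 3.3 (iii)
p.73 (the action of `Π^tp_X` on the functions of `Z^log_∞`) [cite: MochizukiEtTh2009, Def 3.3 p.73].

CLASS (b) MODEL (abc-iut cell, layer L2; seat abc-iut-L2-t3 (gen 7); «2b(ii) KNIT PREP» announced STATUS 2026-08-27 ≈01:31Z; sequel of
this seat's `…ThetaTwistKummerAction` (p482960) and abc-iut-L1-t6's «GRP₃′» `…KummerTwistGroupRShear` (p481663) — both UNTOUCHED,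
`kummerAut` / `pairing` / `thetaShearMat` consumed BY NAME).  Over the level `TateTowerThetaTwist.model (Multiplicative B)` (p480037):
* `shear₀ a` — the translation shear on the root exponents WITH THE SIGN COORDINATE FIXED: `(ε, c, k, t) ↦ (ε, c − a k − a² t, k + 2a t, t)`
  (the `(c,k,t)`-part of abc-iut-L2-t3's `TateTowerTheta.shear`, p477445); at a Kummer level the sign `(−1)^{a t}` of Prop. 1.4 (ii)
  is NOT carried by `ε` but by the roots of unity of the level:
* `corr η a f = (a t)•η ∈ B` — the ROOT-OF-UNITY CORRECTION of the translation `a` on `ϖ̈_m^c Ü_m^k Θ̈_m^t`, `η ∈ B` a parameter (at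
  level `m` with `B = ZMod (M m)`, `M m = (m+2)!`, take `η = 1 = ζ_{M_m}`: `Θ̈_m ↦ ζ_{M_m}^{a} ϖ̈_m^{−a²} Ü_m^{2a} Θ̈_m`, whose
  `M_m/2`-th power is level `0`'s `(−1)^a ϖ̈^{−a²} Ü^{2a} Θ̈`; along a transition of ramification `e` the corrections are compatible
  iff `ι(η_m) = e • η_{m′}` — the same shape as `resFn_kummerAut`'s class condition — `resFn_translAut`);
* **`translAut η a : Fn ≃* Fn`, `(ζ, f) ↦ (ζ · ofAdd((a t)•η), shear₀ a f)`**, **`translAction η : Multiplicative ℤ →* MulAut Fn`**, and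
  **`translGaloisAction η : (model (Multiplicative B)).GaloisAction (Multiplicative ℤ)`** — log-divisors SHIFT and cusps / components
  TRANSLATE exactly as in the `Ÿ`-skeleton's `baseAction` (its `actDIV` / `permCusp` / `permComp` BY NAME), every law PROVED;
* `shearClass a κ = (κ_ϖ, a κ_ϖ + κ_U, −a² κ_ϖ − 2a κ_U + κ_Θ)` — abc-iut-L1-t6's `thetaShearMat a` applied to a `B`-valued class triple
  (`shearClass_eq_mulVec` over `ℤ`), `pairing_shearClass : (σ_a κ)·e(f) = κ·e(shear₀ (−a) f)`;
* **`translAut_kummerAut_symm` / `translAction_conj_kummerAction`: `T_a ∘ K_κ ∘ T_a⁻¹ = K_{σ_a κ}`** — the relation of the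
  shear-semidirect product `Grp 3 thetaShear = K ⋊ (C × ℤ_γ)` realised on the functions of the level, for EVERY correction `η`
  (the input of `SemidirectProduct.lift` for the 2b(ii) action knit).
HONEST LABEL: a combinatorial design model (exponent bookkeeping of Prop. 1.4 at a Kummer level), NOT the tempered fundamental group of a
Tate curve; defs + theorems only, no Prop-valued fact, no instance, no notation, no sorry; nothing here bears on [IUTchIII] Cor. 3.12;
no side taken; typed ≠ proved.
-/

noncomputable section

namespace Literature.AnabelianGeometry.EtaleTheta

open CategoryTheory

namespace LogDivisorModel

namespace TateTowerThetaTwist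

open TateTowerTheta

variable {B : Type} [AddCommGroup B]

/-! ## The sign-fixed shear of the root exponents -/

/-- **The translation shear with the sign coordinate fixed**: `(ε, c, k, t) ↦ (ε, c − a·k − a²·t, k + 2a·t, t)`.
[cite: MochizukiEtTh2009, Prop 1.4 p.22] -/
def shear₀ (a : ℤ) (f : Exp) : Exp := (f.1, eC f - a * eU f - a * a * eT f, eU f + 2 * a * eT f, eT f)

/-- Sign of `shear₀ a f`: unchanged. [cite: MochizukiEtTh2009, Prop 1.4 p.22] -/
@[simp] theorem fst_shear₀ (a : ℤ) (f : Exp) : (shear₀ a f).1 = f.1 := rfl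
/-- `ϖ̈`-exponent of `shear₀ a f`. [cite: MochizukiEtTh2009, Prop 1.4 p.22] -/
@[simp] theorem eC_shear₀ (a : ℤ) (f : Exp) : eC (shear₀ a f) = eC f - a * eU f - a * a * eT f := rfl
/-- `Ü`-exponent of `shear₀ a f`. [cite: MochizukiEtTh2009, Prop 1.4 p.22] -/
@[simp] theorem eU_shear₀ (a : ℤ) (f : Exp) : eU (shear₀ a f) = eU f + 2 * a * eT f := rfl
/-- `Θ̈`-exponent of `shear₀ a f`: unchanged. [cite: MochizukiEtTh2009, Prop 1.4 p.22] -/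
@[simp] theorem eT_shear₀ (a : ℤ) (f : Exp) : eT (shear₀ a f) = eT f := rfl

/-- `shear₀ a` agrees with the `Ÿ`-skeleton's `shear a` on the three root exponents. [cite: MochizukiEtTh2009, Prop 1.4 p.22] -/
theorem eCUT_shear₀ (a : ℤ) (f : Exp) :
    eC (shear₀ a f) = eC (shear a f) ∧ eU (shear₀ a f) = eU (shear a f) ∧ eT (shear₀ a f) = eT (shear a f) := ⟨rfl, rfl, rfl⟩

/-- `shear₀ a` is additive. [cite: MochizukiEtTh2009, Prop 1.4 p.22] -/
theorem shear₀_add_fun (a : ℤ) (f g : Exp) : shear₀ a (f + g) = shear₀ a f + shear₀ a g :=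
  ext_exp rfl (by simp only [eC_shear₀, eC_add, eU_add, eT_add]; ring) (by simp only [eU_shear₀, eU_add, eT_add]; ring) rfl

/-- `shear₀ 0 = id`. [cite: MochizukiEtTh2009, Prop 1.4 p.22] -/
theorem shear₀_zero (f : Exp) : shear₀ 0 f = f :=
  ext_exp rfl (by rw [eC_shear₀]; ring) (by rw [eU_shear₀]; ring) rfl

/-- `shear₀ (a + a') = shear₀ a ∘ shear₀ a'` (the shears form a representation of `ℤ`). [cite: MochizukiEtTh2009, Prop 1.4 p.22] -/
theorem shear₀_add (a a' : ℤ) (f : Exp) : shear₀ (a + a') f = shear₀ a (shear₀ a' f) :=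
  ext_exp rfl (by simp only [eC_shear₀, eU_shear₀, eT_shear₀]; ring) (by simp only [eU_shear₀, eT_shear₀]; ring) rfl

/-- Constants (`eU = eT = 0`) are fixed by every shear. [cite: MochizukiEtTh2009, Prop 1.4 p.22] -/
theorem shear₀_eq_self_of_const (a : ℤ) {e : Exp} (hk : eU e = 0) (ht : eT e = 0) : shear₀ a e = e :=
  ext_exp rfl (by rw [eC_shear₀, hk, ht]; ring) (by rw [eU_shear₀, hk, ht]; ring) rfl

/-- Divisors of sheared functions: the sign is invisible, so `div(shear₀ a f) = div(shear a f)` (the shifted divisor).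
[cite: MochizukiEtTh2009, Prop 1.4 p.22] -/
theorem divFun_shear₀ (a : ℤ) (f : Exp) (x : TateTowerTheta.Idx) : divFun (shear₀ a f) x = divFun (shear a f) x := by
  rcases x with c | j
  · rw [divFun_inl, divFun_inl, eT_shear₀, eT_shear]
  · rw [divFun_inr, divFun_inr, eC_shear₀, eU_shear₀, eT_shear₀, eC_shear, eU_shear, eT_shear]

/-- `shear₀ a` on the multiplicative functions of the skeleton. [cite: MochizukiEtTh2009, Prop 1.4 p.22] -/
def shear₀Fn (a : ℤ) : Multiplicative Exp ≃* Multiplicative Exp where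
  toFun f := Multiplicative.ofAdd (shear₀ a (Multiplicative.toAdd f))
  invFun f := Multiplicative.ofAdd (shear₀ (-a) (Multiplicative.toAdd f))
  left_inv f := Multiplicative.toAdd.injective (by simp only [toAdd_ofAdd, ← shear₀_add, neg_add_cancel, shear₀_zero])
  right_inv f := Multiplicative.toAdd.injective (by simp only [toAdd_ofAdd, ← shear₀_add, add_neg_cancel, shear₀_zero])
  map_mul' f g := Multiplicative.toAdd.injective (by simp only [toAdd_ofAdd, toAdd_mul, shear₀_add_fun])

/-- `shear₀Fn a f` evaluated. [cite: MochizukiEtTh2009, Prop 1.4 p.22] -/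
@[simp] theorem toAdd_shear₀Fn (a : ℤ) (f : Multiplicative Exp) :
    Multiplicative.toAdd (shear₀Fn a f) = shear₀ a (Multiplicative.toAdd f) := rfl

/-! ## The root-of-unity correction of the translations -/

/-- **`corr η a f = (a·t)•η`** — the exponent of the root of unity `η` picked up by `ϖ̈_m^c Ü_m^k Θ̈_m^t` under the translation `a`
(at level `0`, `η = −1`: the sign `(−1)^{a t}` of Prop. 1.4 (ii)). [cite: MochizukiEtTh2009, Prop 1.4 p.22] -/
def corr (η : B) (a : ℤ) (f : Exp) : B := (a * eT f) • η

/-- The correction is additive in the function. [cite: MochizukiEtTh2009, Prop 1.4 p.22] -/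
theorem corr_add_fun (η : B) (a : ℤ) (f g : Exp) : corr η a (f + g) = corr η a f + corr η a g := by
  rw [corr, corr, corr, eT_add, mul_add, add_smul]

/-- The correction along a product of functions of the skeleton. [cite: MochizukiEtTh2009, Prop 1.4 p.22] -/
theorem corr_toAdd_mul (η : B) (a : ℤ) (f g : TateTowerTheta.model.Fn) :
    corr η a (Multiplicative.toAdd (f * g)) = corr η a (Multiplicative.toAdd f) + corr η a (Multiplicative.toAdd g) :=
  corr_add_fun η a _ _

/-- The correction only sees the (shear-invariant) `Θ̈`-exponent. [cite: MochizukiEtTh2009, Prop 1.4 p.22] -/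
@[simp] theorem corr_shear₀ (η : B) (a b : ℤ) (f : Exp) : corr η a (shear₀ b f) = corr η a f := by rw [corr, corr, eT_shear₀]

/-- The correction is a cocycle (indeed additive) in the translation. [cite: MochizukiEtTh2009, Prop 1.4 p.22] -/
theorem corr_add (η : B) (a a' : ℤ) (f : Exp) : corr η (a + a') f = corr η a f + corr η a' f := by
  rw [corr, corr, corr, add_mul, add_smul]

/-- The trivial translation needs no correction. [cite: MochizukiEtTh2009, Prop 1.4 p.22] -/
@[simp] theorem corr_zero (η : B) (f : Exp) : corr η 0 f = 0 := by rw [corr, zero_mul, zero_smul]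

/-! ## The translations acting on the functions of the level -/

/-- **`T_a : (ζ, f) ↦ (ζ · η^{a t}, shear₀ a f)`** — the translation `a ∈ ℤ_γ` on the functions `μ × Fn(skeleton)` of the level, with
root-of-unity correction `η`. [cite: MochizukiEtTh2009, Def 3.3 p.73] -/
def translAut (η : B) (a : ℤ) : Fn (Multiplicative B) ≃* Fn (Multiplicative B) where
  toFun x := (x.1 * Multiplicative.ofAdd (corr η a (Multiplicative.toAdd x.2)), shear₀Fn a x.2)
  invFun x := (x.1 / Multiplicative.ofAdd (corr η a (Multiplicative.toAdd x.2)), shear₀Fn (-a) x.2)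
  left_inv x := Prod.ext
    (show x.1 * Multiplicative.ofAdd (corr η a (Multiplicative.toAdd x.2)) /
        Multiplicative.ofAdd (corr η a (shear₀ a (Multiplicative.toAdd x.2))) = x.1 by rw [corr_shear₀, mul_div_cancel_right])
    ((shear₀Fn a).left_inv x.2)
  right_inv x := Prod.ext
    (show x.1 / Multiplicative.ofAdd (corr η a (Multiplicative.toAdd x.2)) *
        Multiplicative.ofAdd (corr η a (shear₀ (-a) (Multiplicative.toAdd x.2))) = x.1 by rw [corr_shear₀, div_mul_cancel])
    ((shear₀Fn a).right_inv x.2)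
  map_mul' x y := Prod.ext
    (show x.1 * y.1 * Multiplicative.ofAdd (corr η a (Multiplicative.toAdd (x.2 * y.2))) =
        x.1 * Multiplicative.ofAdd (corr η a (Multiplicative.toAdd x.2)) *
          (y.1 * Multiplicative.ofAdd (corr η a (Multiplicative.toAdd y.2))) by
      rw [corr_toAdd_mul, ofAdd_add, mul_mul_mul_comm])
    (map_mul (shear₀Fn a) x.2 y.2)

/-- `T_a` on the root-of-unity coordinate. [cite: MochizukiEtTh2009, Def 3.3 p.73] -/
@[simp] theorem translAut_fst (η : B) (a : ℤ) (x : Fn (Multiplicative B)) :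
    (translAut η a x).1 = x.1 * Multiplicative.ofAdd (corr η a (Multiplicative.toAdd x.2)) := rfl

/-- `T_a` on the skeleton part: the sign-fixed shear. [cite: MochizukiEtTh2009, Def 3.3 p.73] -/
@[simp] theorem translAut_snd (η : B) (a : ℤ) (x : Fn (Multiplicative B)) : (translAut η a x).2 = shear₀Fn a x.2 := rfl

/-- `T_a⁻¹` on the root-of-unity coordinate. [cite: MochizukiEtTh2009, Def 3.3 p.73] -/
@[simp] theorem translAut_symm_fst (η : B) (a : ℤ) (x : Fn (Multiplicative B)) :
    ((translAut η a).symm x).1 = x.1 / Multiplicative.ofAdd (corr η a (Multiplicative.toAdd x.2)) := rfl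

/-- `T_a⁻¹` on the skeleton part. [cite: MochizukiEtTh2009, Def 3.3 p.73] -/
@[simp] theorem translAut_symm_snd (η : B) (a : ℤ) (x : Fn (Multiplicative B)) :
    ((translAut η a).symm x).2 = shear₀Fn (-a) x.2 := rfl

/-- `T_0 = id`. [cite: MochizukiEtTh2009, Def 3.3 p.73] -/
theorem translAut_zero (η : B) : translAut η 0 = MulEquiv.refl _ :=
  MulEquiv.ext fun x => Prod.ext (by rw [translAut_fst, corr_zero, ofAdd_zero, mul_one]; rfl)
    (Multiplicative.toAdd.injective (show shear₀ 0 (Multiplicative.toAdd x.2) = Multiplicative.toAdd x.2 from shear₀_zero _))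

/-- `T_{a+a'} = T_a ∘ T_{a'}`. [cite: MochizukiEtTh2009, Def 3.3 p.73] -/
theorem translAut_add (η : B) (a a' : ℤ) : translAut η (a + a') = (translAut η a').trans (translAut η a) :=
  MulEquiv.ext fun x => Prod.ext
    (show x.1 * Multiplicative.ofAdd (corr η (a + a') (Multiplicative.toAdd x.2)) =
        x.1 * Multiplicative.ofAdd (corr η a' (Multiplicative.toAdd x.2)) *
          Multiplicative.ofAdd (corr η a (shear₀ a' (Multiplicative.toAdd x.2))) by
      rw [corr_shear₀, corr_add, add_comm, ofAdd_add, mul_assoc])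
    (Multiplicative.toAdd.injective (by
      change shear₀ (a + a') (Multiplicative.toAdd x.2) = shear₀ a (shear₀ a' (Multiplicative.toAdd x.2))
      exact shear₀_add a a' _))

/-- **The translations `ℤ_γ` acting on the functions of the level** (`a ↦ T_a`, a homomorphism). [cite: MochizukiEtTh2009, Def 3.3 p.73] -/
def translAction (η : B) : Multiplicative ℤ →* MulAut (Fn (Multiplicative B)) where
  toFun a := translAut η (Multiplicative.toAdd a)
  map_one' := by rw [toAdd_one, translAut_zero]; rfl
  map_mul' a a' := by rw [toAdd_mul, translAut_add]; rfl

/-- `translAction η a = T_a`. [cite: MochizukiEtTh2009, Def 3.3 p.73] -/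
@[simp] theorem translAction_apply (η : B) (a : Multiplicative ℤ) (x : Fn (Multiplicative B)) :
    translAction η a x = translAut η (Multiplicative.toAdd a) x := rfl

/-- **On the generators**: `Θ̈_m ↦ η^{a} · ϖ̈_m^{−a²} Ü_m^{2a} Θ̈_m` (Prop. 1.4 (ii) at the level). [cite: MochizukiEtTh2009, Prop 1.4 p.22] -/
theorem translAut_theta (η : B) (a : ℤ) :
    translAut η a (theta (Multiplicative B)) =
      (Multiplicative.ofAdd (a • η), Multiplicative.ofAdd (((0 : ZMod 2), -(a * a), 2 * a, (1 : ℤ)) : Exp)) :=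
  by
  refine Prod.ext ?_ (Multiplicative.toAdd.injective (ext_exp rfl ?_ ?_ rfl))
  · show 1 * Multiplicative.ofAdd (corr η a ((0, 0, 0, 1) : Exp)) = Multiplicative.ofAdd (a • η)
    rw [one_mul, corr]
    show Multiplicative.ofAdd ((a * 1) • η) = _
    rw [mul_one]
  · show eC (shear₀ a ((0, 0, 0, 1) : Exp)) = -(a * a)
    rw [eC_shear₀]
    show (0 : ℤ) - a * 0 - a * a * 1 = -(a * a)
    ring
  · show eU (shear₀ a ((0, 0, 0, 1) : Exp)) = 2 * a
    rw [eU_shear₀]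
    show (0 : ℤ) + 2 * a * 1 = 2 * a
    ring

/-- `Ü_m ↦ ϖ̈_m^{−a} Ü_m` (no root of unity). [cite: MochizukiEtTh2009, Prop 1.4 p.22] -/
theorem translAut_coordU (η : B) (a : ℤ) :
    translAut η a (coordU (Multiplicative B)) = (1, Multiplicative.ofAdd (((0 : ZMod 2), -a, (1 : ℤ), (0 : ℤ)) : Exp)) :=
  by
  refine Prod.ext ?_ (Multiplicative.toAdd.injective (ext_exp rfl ?_ ?_ rfl))
  · show 1 * Multiplicative.ofAdd (corr η a ((0, 0, 1, 0) : Exp)) = 1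
    rw [one_mul, corr]
    show Multiplicative.ofAdd ((a * 0) • η) = 1
    rw [mul_zero, zero_smul]
    rfl
  · show eC (shear₀ a ((0, 0, 1, 0) : Exp)) = -a
    rw [eC_shear₀]
    show (0 : ℤ) - a * 1 - a * a * 0 = -a
    ring
  · show eU (shear₀ a ((0, 0, 1, 0) : Exp)) = 1
    rw [eU_shear₀]
    show (1 : ℤ) + 2 * a * 0 = 1
    ring

/-- Constants `(ζ, ±ϖ̈_m^c)` are fixed by every translation. [cite: MochizukiEtTh2009, Def 3.3 p.73] -/
theorem translAut_of_const [Finite B] (η : B) (a : ℤ) {x : Fn (Multiplicative B)} (hx : x ∈ (model (Multiplicative B)).const) :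
    translAut η a x = x :=
  by
  have h : eU (Multiplicative.toAdd x.2) = 0 ∧ eT (Multiplicative.toAdd x.2) = 0 := (mem_const_iff _ x).mp hx
  refine Prod.ext ?_ (Multiplicative.toAdd.injective ?_)
  · rw [translAut_fst, corr, h.2, mul_zero, zero_smul, ofAdd_zero, mul_one]
  · show shear₀ a (Multiplicative.toAdd x.2) = Multiplicative.toAdd x.2
    exact shear₀_eq_self_of_const a h.1 h.2

/-! ## The translations are structure-preserving: a `GaloisAction` of `ℤ_γ` on the level -/

variable [Finite B]

/-- **The translations `ℤ_γ` as a `GaloisAction` on the level `TateTowerThetaTwist.model μ`**: functions by `T_a` (root-of-unity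
corrected), log-divisors / cusps / components by the `Ÿ`-skeleton's `baseAction` (shift by `a`); every law PROVED — divisors shift,
constants and integral constants are preserved. [cite: MochizukiEtTh2009, Def 3.3 p.73] -/
def translGaloisAction (η : B) : (model (Multiplicative B)).GaloisAction (Multiplicative ℤ) where
  actFn := translAction η
  actDIV := TateTowerTheta.baseAction.actDIV
  permCusp := TateTowerTheta.baseAction.permCusp
  permComp := TateTowerTheta.baseAction.permComp
  act_mem_DIVplus := TateTowerTheta.baseAction.act_mem_DIVplus
  act_mem_Div := TateTowerTheta.baseAction.act_mem_Div
  act_mem_logMero _ _ _ := trivial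
  act_mem_const g f hf := by
    have hf' : eU (Multiplicative.toAdd f.2) = 0 ∧ eT (Multiplicative.toAdd f.2) = 0 := hf
    refine ⟨?_, ?_⟩
    · change eU (shear₀ (Multiplicative.toAdd g) (Multiplicative.toAdd f.2)) = 0
      rw [eU_shear₀, hf'.1, hf'.2, mul_zero, add_zero]
    · change eT (shear₀ (Multiplicative.toAdd g) (Multiplicative.toAdd f.2)) = 0
      rw [eT_shear₀, hf'.2]
  act_mem_intConst g f hf := by
    have hf' : 0 ≤ eC (Multiplicative.toAdd f.2) ∧ eU (Multiplicative.toAdd f.2) = 0 ∧ eT (Multiplicative.toAdd f.2) = 0 := hf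
    refine ⟨?_, ?_, ?_⟩
    · change 0 ≤ eC (shear₀ (Multiplicative.toAdd g) (Multiplicative.toAdd f.2))
      rw [eC_shear₀, hf'.2.1, hf'.2.2, mul_zero, mul_zero, sub_zero, sub_zero]
      exact hf'.1
    · change eU (shear₀ (Multiplicative.toAdd g) (Multiplicative.toAdd f.2)) = 0
      rw [eU_shear₀, hf'.2.1, hf'.2.2, mul_zero, add_zero]
    · change eT (shear₀ (Multiplicative.toAdd g) (Multiplicative.toAdd f.2)) = 0
      rw [eT_shear₀, hf'.2.2]
  divisor_act g f := by
    refine Multiplicative.toAdd.injective (funext fun x => ?_)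
    change divFun (shear₀ (Multiplicative.toAdd g) (Multiplicative.toAdd f.1.2)) x =
      Multiplicative.toAdd (shiftDIV (Multiplicative.toAdd g) (divHom f.1.2)) x
    rw [divFun_shear₀, toAdd_shiftDIV, toAdd_divHom]
    rcases x with ⟨j, b⟩ | j
    · rw [shiftIdx_symm_inl, divFun_inl, divFun_inl, eT_shear]
    · rw [shiftIdx_symm_inr, divFun_inr, divFun_inr, eC_shear, eU_shear, eT_shear]
      ring
  mult_act := TateTowerTheta.baseAction.mult_act

/-- The translations move log-divisors as on the `Ÿ`-skeleton. [cite: MochizukiEtTh2009, Def 3.3 p.73] -/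
theorem translGaloisAction_actDIV (η : B) :
    (translGaloisAction (B := B) η).actDIV = TateTowerTheta.baseAction.actDIV := rfl

/-- The translations on functions are the `T_a`. [cite: MochizukiEtTh2009, Def 3.3 p.73] -/
theorem translGaloisAction_actFn (η : B) (a : Multiplicative ℤ) (x : Fn (Multiplicative B)) :
    (translGaloisAction (B := B) η).actFn a x = translAut η (Multiplicative.toAdd a) x := rfl

/-! ## The Heisenberg-type relation with the Kummer action: `T_a K_κ T_a⁻¹ = K_{σ_a κ}` -/

omit [Finite B]

/-- **`σ_a κ`** — abc-iut-L1-t6's theta shear `thetaShearMat a` applied to a `B`-valued class triple: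
`(κ_ϖ, κ_U, κ_Θ) ↦ (κ_ϖ, a κ_ϖ + κ_U, −a² κ_ϖ − 2a κ_U + κ_Θ)`. [cite: MochizukiEtTh2009, Prop 1.4 p.22] -/
def shearClass (a : ℤ) (κ : Fin 3 → B) : Fin 3 → B :=
  ![κ 0, a • κ 0 + κ 1, -((a * a) • κ 0) - (2 * a) • κ 1 + κ 2]

/-- `(σ_a κ)_ϖ = κ_ϖ`. [cite: MochizukiEtTh2009, Prop 1.4 p.22] -/
@[simp] theorem shearClass_zero (a : ℤ) (κ : Fin 3 → B) : shearClass a κ 0 = κ 0 := rfl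
/-- `(σ_a κ)_U = a κ_ϖ + κ_U`. [cite: MochizukiEtTh2009, Prop 1.4 p.22] -/
@[simp] theorem shearClass_one (a : ℤ) (κ : Fin 3 → B) : shearClass a κ 1 = a • κ 0 + κ 1 := rfl
/-- `(σ_a κ)_Θ = −a² κ_ϖ − 2a κ_U + κ_Θ`. [cite: MochizukiEtTh2009, Prop 1.4 p.22] -/
@[simp] theorem shearClass_two (a : ℤ) (κ : Fin 3 → B) : shearClass a κ 2 = -((a * a) • κ 0) - (2 * a) • κ 1 + κ 2 := rfl

/-- Over `ℤ`, `σ_a κ` IS abc-iut-L1-t6's `thetaShearMat a` acting on `κ` (p481663, BY NAME). [cite: MochizukiEtTh2009, Prop 1.4 p.22] -/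
theorem shearClass_eq_mulVec (a : ℤ) (κ : Fin 3 → ℤ) :
    shearClass a κ = Matrix.mulVec (TateTowerKummerTwistRShear.thetaShearMat a) κ := by
  rw [TateTowerKummerTwistRShear.thetaShearMat_mulVec]
  ext i
  fin_cases i <;> simp [shearClass]

/-- **The exponent identity behind `T_a K_κ T_a⁻¹ = K_{σ_a κ}`**: `(σ_a κ)·e(f) = κ·e(shear₀ (−a) f)` (abc-iut-L1-t6's
`thetaShear_pairing_shear`, here for `B`-valued classes and the sign-fixed shear). [cite: MochizukiEtTh2009, Prop 1.4 p.22] -/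
theorem pairing_shearClass (a : ℤ) (κ : Fin 3 → B) (f : Exp) : pairing (shearClass a κ) f = pairing κ (shear₀ (-a) f) := by
  simp only [pairing, shearClass_zero, shearClass_one, shearClass_two, eC_shear₀, eU_shear₀, eT_shear₀, smul_add, smul_sub, smul_neg,
    smul_smul, add_smul, sub_smul]
  module

/-- **`T_a (K_κ (T_a⁻¹ x)) = K_{σ_a κ} x`** for every correction `η`, translation `a`, class triple `κ` and function `x` of the level.
[cite: MochizukiEtTh2009, Def 3.3 p.73] -/
theorem translAut_kummerAut_symm (η : B) (a : ℤ) (κ : Fin 3 → B) (x : Fn (Multiplicative B)) :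
    translAut η a (kummerAut κ ((translAut η a).symm x)) = kummerAut (shearClass a κ) x := by
  refine Prod.ext ?_ (Multiplicative.toAdd.injective ?_)
  · show x.1 / Multiplicative.ofAdd (corr η a (Multiplicative.toAdd x.2)) *
          Multiplicative.ofAdd (pairing κ (shear₀ (-a) (Multiplicative.toAdd x.2))) *
        Multiplicative.ofAdd (corr η a (shear₀ (-a) (Multiplicative.toAdd x.2))) =
      x.1 * Multiplicative.ofAdd (pairing (shearClass a κ) (Multiplicative.toAdd x.2))
    rw [corr_shear₀, pairing_shearClass, mul_right_comm, div_mul_cancel]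
  · show shear₀ a (shear₀ (-a) (Multiplicative.toAdd x.2)) = Multiplicative.toAdd x.2
    rw [← shear₀_add, add_neg_cancel, shear₀_zero]
    exact rfl

/-- The same as an identity of automorphisms: `T_a⁻¹ ≫ K_κ ≫ T_a = K_{σ_a κ}`. [cite: MochizukiEtTh2009, Def 3.3 p.73] -/
theorem translAut_conj_kummerAut (η : B) (a : ℤ) (κ : Fin 3 → B) :
    ((translAut η a).symm.trans (kummerAut κ)).trans (translAut η a) = kummerAut (shearClass a κ) :=
  MulEquiv.ext fun x => translAut_kummerAut_symm η a κ x

/-- **In `MulAut Fn`: `T_a * K_κ * T_a⁻¹ = K_{σ_a κ}`** — the relation of the shear-semidirect product `K ⋊ (C × ℤ_γ)` («GRP₃′»)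
realised on the functions of the level (the input of `SemidirectProduct.lift` for the 2b(ii) action knit). [cite: MochizukiEtTh2009, Def 3.3 p.73] -/
theorem translAction_conj_kummerAction (η : B) (a : Multiplicative ℤ) (κ : Multiplicative (Fin 3 → B)) :
    translAction η a * kummerAction κ * (translAction η a)⁻¹ =
      kummerAction (Multiplicative.ofAdd (shearClass (Multiplicative.toAdd a) (Multiplicative.toAdd κ))) := by
  refine MulEquiv.ext fun x => ?_
  show translAut η (Multiplicative.toAdd a) (kummerAut (Multiplicative.toAdd κ) ((translAut η (Multiplicative.toAdd a)).symm x)) =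
    kummerAut (Multiplicative.toAdd (Multiplicative.ofAdd (shearClass (Multiplicative.toAdd a) (Multiplicative.toAdd κ)))) x
  rw [toAdd_ofAdd]
  exact translAut_kummerAut_symm η _ _ x

/-! ## Compatibility with the level transitions -/

variable {B' : Type} [AddCommGroup B']

/-- `shear₀` commutes with the transition of the exponents (it is `ℤ`-linear on `(c, k, t)` and fixes the sign).
[cite: MochizukiEtTh2009, Def 3.3 (iii) p.74] -/
theorem resExp_shear₀ (e : ℕ) (a : ℤ) (f : Exp) : resExp e (shear₀ a f) = shear₀ a (resExp e f) :=
  ext_exp rfl (by simp only [eC_resExp, eC_shear₀, eU_resExp, eT_resExp]; ring)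
    (by simp only [eU_resExp, eU_shear₀, eT_resExp]; ring) rfl

/-- **RES-COMPATIBILITY of the translations**: along a transition `resFn ι e` the corrected translations agree, `res ∘ T_a = T_a ∘ res`,
whenever the corrections are compatible, `ι(η) = e • η′` (e.g. `η_m = ζ_{M_m} = 1 ∈ ZMod (M m)` at every level, `ι` = multiplication
by `e = M_{m′}/M_m`). [cite: MochizukiEtTh2009, Def 3.3 (iii) p.74] -/
theorem resFn_translAut (ι : B →+ B') (e : ℕ) {η : B} {η' : B'} (hη : ι η = (e : ℤ) • η') (a : ℤ) (x : Fn (Multiplicative B)) :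
    resFn ι e (translAut η a x) = translAut η' a (resFn ι e x) := by
  refine Prod.ext ?_ ?_
  · rw [resFn_apply, translAut_fst, translAut_fst, resFn_apply]
    change Multiplicative.ofAdd (ι (Multiplicative.toAdd x.1 + corr η a (Multiplicative.toAdd x.2))) =
      Multiplicative.ofAdd (ι (Multiplicative.toAdd x.1)) * Multiplicative.ofAdd (corr η' a (resExp e (Multiplicative.toAdd x.2)))
    rw [map_add, ofAdd_add, corr, corr, map_zsmul, hη, smul_smul, eT_resExp, ← mul_assoc, mul_right_comm]
  · rw [resFn_apply, translAut_snd, translAut_snd, resFn_apply]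
    change Multiplicative.ofAdd (resExp e (shear₀ a (Multiplicative.toAdd x.2))) =
      Multiplicative.ofAdd (shear₀ a (resExp e (Multiplicative.toAdd x.2)))
    rw [resExp_shear₀]

end TateTowerThetaTwist

end LogDivisorModel

end Literature.AnabelianGeometry.EtaleTheta

end
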